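import Summits.QuantumFields.BalabanUV.T4Continuum.Spine.NE1p.DressedSmallFieldSlotLettersWitnessMass
import Summits.QuantumFields.BalabanUV.T4Continuum.Spine.NE1p.DressedSmallFieldTorusWitnessSharp

/-!
# T⁴ programme, spine estimate NE1′ (node O3b/H2) — WITNESS W⟨next⟩ (follower of W58 «THE SLOT-LETTERS END FIRES ON THE TORUS»): THE
# ϱ-FREE SHARP-ROOM-3 ENDs FIRE ON W58's DATUM — S31 §1's `attachedPart_locE_le_of_coreLettersOf_printClause_three_torus`, S36 §2's
# `attachedPart_locE_le_of_coreLettersOf_factorMass_printClause_three_torus` and S38 §2's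
# `attachedPart_locE_le_of_coreLettersOf_herm_printClause_three_torus` APPLIED ONCE BY NAME each, for EVERY driven two-run object `D` and
# EVERY run-B background `U`, at the live slope `A₀ = A₁ = A₃ := (3·(e·K₀(64,8)·9·64))⁻¹ = A∕3` where the factor-3 clause holds WITH
# EQUALITY and the factor-4 clause FAILS (this lineage's gen-12 located arithmetic BY NAME) — NO radius binder; the bounded quantity is
# LITERALLY W58 PART 2 §5's, now bounded by `4∕3·K₀(64,8)` instead of PART 2's closed `2·K₀(64,8)`

Cell `pub-balaban`, sub-cell `t4`, row NE1′ formalisation crew (`t4/formal/NE1p/LEAVES.md` row W⟨next⟩ — own-initiative follower of the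
O-g15a tail `DressedSmallFieldSlotLettersWitnessMu` (p239626); INTENT `CLAIMS.log` l.⟨this gen⟩), unit `b2b-balaban-t4-ne1p-formalise-leaf-04`
(LEAF PROVER 04, gen 16).  ADDITIVE — imports W58 PART 3 `Spine/NE1p/DressedSmallFieldSlotLettersWitnessMass` (⇒ PART 2: `termsW`, `wW`,
`actSW`, `hM3_W`, `slotLettersEnd_live`, `slotLettersEnd_fires_torus_closed`; PART 1: `AW D`, `PW D`, `ctrW D`, `hbase_W`∕`hrdm_W`∕`hrd_W`∕
`hctr_W`∕`hbud_W`∕`hmq_W`; PART 3: `hfloor_W`, `hent_W`, `hherm_W`, `hco_W`, `hbud_herm_W`, `hF3_W`, `hF3_herm_W`; ⇒ S31, S38 ⇒ S36) and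
this lineage's gen-12 `Spine/NE1p/DressedSmallFieldTorusWitnessSharp` (p227345: the located arithmetic `prefactor3_pos`, `h3_torus`,
`pencilRadius_three`, `not_h4_at_A3`, `A3_eq` at `A₃`) ONLY — both LANDED; THEOREMS ONLY (0 def, 0 `def … : Prop`, 0 cite, 0 sorry);
nothing of S31 ∕ S36 ∕ S38 ∕ W58 ∕ the gen-12 module restated — used BY NAME.

WHAT.  S31 §1 ∕ S36 §2 ∕ S38 §2 each carry the ϱ-FREE form of their slot END (N0m §4∕§4b's sharp room 3: live slope `0 < A₁ ≤ A₀`,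
`h3 : 3·A₀·(e^{5r₁+1}·K₀(64,8)·9·64) ≤ 1`, `hH` and (B3)'s growth letter READ AT `ϱ⋆ := max 2 (A₀∕A₁)` — NO radius binder); no module
applies them (grep at INTENT: each name occurs in its own module only).  On W58's datum, at `A₀ = A₁ = A₃`:
* §16 the located arithmetic is this lineage's gen-12 BY NAME (`h3_torus` — the factor-3 clause at `r₁ = 0`, `pencilRadius_three` —
  `max 2 (A₃∕A₃) = 2`, `not_h4_at_A3` — the factor-4 clause is FALSE at `A₃`); new here: **`h3_W_eq`** (the clause holds WITH EQUALITY —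
  the sharp room is EXHAUSTED at `A₃`), `budget_A3` (`A₃ + 2·A₃ = 0 + 2·(A∕2)` — the pencil budget at `ϱ⋆ = 2` IS PART 2's budget, so
  (B3) is PART 2∕3's `hM3_W`∕`hF3_W`∕`hF3_herm_W` after `pencilRadius_three`: `hM3_sharp_W`, `hF3_sharp_W`, `hF3_herm_sharp_W`);
* §17 **`slotLettersSharpEnd_fires_torus D N U k`** = S31 §1's ϱ-free END APPLIED ONCE BY NAME (`hle := le_rfl`, `h3 := h3_torus`, `hH` at
  radius `max 2 (A₃∕A₃)`), conclusion LITERAL — its LEFT side IS PART 2 §5's bounded quantity (`w := wW D`, table `0 + wW D`);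
  `_closed`: `≤ 4∕3·K₀(64,8)`; **`slotLettersMassSharpEnd_fires_torus`** (S36 §2 ONCE), **`slotLettersHermSharpEnd_fires_torus`** (S38 §2 ONCE);
* §18 GENUINE: `sharp_lt_radiusRoute` (`4∕3·K₀(64,8) < 2·K₀(64,8)`: on the SAME quantity the ϱ-free sharp END's closed constant is 2∕3 of
  PART 2 §5's radius-route constant `slotLettersEnd_fires_torus_closed` — an observation about OUR constants only), `slotLettersSharpEnd_live`
  (the quantity is `≠ 0` — PART 2 §6 `slotLettersEnd_live` BY NAME — AND `≤ 4∕3·K₀(64,8)`); the factor-4 clause of N0m §4 FAILS at this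
  slope — gen-12's `not_h4_at_A3`, cited BY NAME, not restated (the gate's dedup): the sharp room is load-bearing for THIS datum at THIS
  slope; `_SU2` at `DW`∕`UW`.

HONEST FRAMING (typer R-T133∕R-T137∕R-T138 wording + rider ADOPTED).  A DECIDED TOY ([folklore]; 0 sorry; 0 citations; no `def`): three
by-name ϱ-free re-letterings of the crew's slot ENDs applied ONCE each to PART 1's `ActLetters` datum at a slope OF OUR CHOOSING — a vacuity
check of the printClause-three faces of S31 §1 ∕ S36 §2 ∕ S38 §2 (hence of N0m §4b's sharp room at the letters of record); the factor `3`,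
`A₃` and every numeral are OUR arithmetic on the owner's clause SHAPES and pv22's PROVED constants — k2: no numeral of [Balaban1988RGII]
asserted (p. 20∕p. 21's «ε₁ sufficiently small» clauses are TYPE∕CONTEXT through N0m's header only); nothing of Bałaban's (2.14) data;
(B1b) by definition of the toy; (B3) `hM3`∕`hF3` met BY CHOICE of `rW` — G-ne9p2-5 UNPRINTED for Bałaban's cores; 0 binders instantiated
on Bałaban's densities; no wall item; the NE1′ wall (wording v1.8, T4-DAG v48∕v49; kind v1.7) does NOT move; R-t4r2-Q2 NOT met thereby;
NE1′ ⇐ the named binders — NOT proved, NOT printed; spine PROVED 0∕9; count 9 unchanged.  Rung (B)+1 on ONE finite four-torus — NOT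
infinite volume, NOT a mass gap, NOT OS on ℝ⁴, NOT Clay.  HONEST DEPENDENCY: continuum YM on T⁴ ⇐ BetaPertH ∧ nine spine estimates (0/9
proved); BetaPertH ⇐ (D1) ∧ (D4) ∧ CAP+tail; G-an2-4 gates asym, D1 and NE2/3/4.
-/

noncomputable section

namespace Summit.QuantumFields.BalabanUV.T4Continuum.NE1p.DressedSmallFieldSlotLettersWitnessSharp

open Set Metric MeasureTheory Complex
open scoped BigOperators Matrix
open Literature.MathematicalPhysics.QuantumFieldTheory.Balaban1983to89
open Literature.MathematicalPhysics.QuantumFieldTheory.Balaban1983to89.B12TreeDecay (K₀ K₀_pos)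
open Literature.MathematicalPhysics.QuantumFieldTheory.Balaban1983to89.B13Resummation (locE)
open Literature.MathematicalPhysics.QuantumFieldTheory.Balaban1983to89.TreeLengthTorus (TDom tsys torusTreeLen torusTreeLen_singleton)
open Literature.MathematicalPhysics.QuantumFieldTheory.Balaban1983to89.TreeLengthTorusGeometry (tgeometry TTouch)
open Summit.QuantumFields.BalabanUV.T4Continuum.B13HistMeasurable (MeasPotFrame B13HistM)
open Summit.QuantumFields.BalabanUV.T4Continuum.B13Carriers (TwoRuns singleDom)
open Summit.QuantumFields.BalabanUV.T4Continuum.SubstrateTwoRunsDriven (DrivenRuns)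
open Summit.QuantumFields.BalabanUV.T4Continuum.SubstrateActivities (CoreLetters coreOf actOfLetters)
open Summit.QuantumFields.BalabanUV.T4Continuum.SubstrateGaussianLetters (gaussC)
open Summit.QuantumFields.BalabanUV.T4Continuum.SubstrateSlotsOfRecord (ActLetters coreLettersOf)
open Summit.QuantumFields.BalabanUV.T4Continuum.NE1p.DressedSmallFieldOnCoresSlotLettersTorus
  (attachedPart_locE_le_of_coreLettersOf_printClause_three_torus)
open Summit.QuantumFields.BalabanUV.T4Continuum.NE1p.DressedSmallFieldOnCoresSlotLettersMassTorus
  (attachedPart_locE_le_of_coreLettersOf_factorMass_printClause_three_torus)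
open Summit.QuantumFields.BalabanUV.T4Continuum.NE1p.DressedSmallFieldOnCoresSlotLettersHermTorus
  (attachedPart_locE_le_of_coreLettersOf_herm_printClause_three_torus)
open Summit.QuantumFields.BalabanUV.T4Continuum.B13TermCoreMass (factorMass)
open Summit.QuantumFields.BalabanUV.T4Continuum.NE1p.DressedSmallFieldCoresWitness (E1 Acst Acst_pos)
open Summit.QuantumFields.BalabanUV.T4Continuum.NE1p.DressedSmallFieldTorusWitness (X₀ X₀_val eq_X₀_iff hrate_torus_num prefactor_pos)
open Summit.QuantumFields.BalabanUV.T4Continuum.NE1p.DressedSmallFieldTorusWitnessSharp (prefactor3_pos h3_torus pencilRadius_three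
  not_h4_at_A3 A3_eq)
open Summit.QuantumFields.BalabanUV.T4Continuum.NE1p.DressedSmallFieldSlotLettersWitness
open Summit.QuantumFields.BalabanUV.T4Continuum.NE1p.DressedSmallFieldSlotLettersWitnessEnd
open Summit.QuantumFields.BalabanUV.T4Continuum.NE1p.DressedSmallFieldSlotLettersWitnessMass

variable {G : Type} [GaugeGroup G] (D : DrivenRuns G)

/-! ## §16 The located arithmetic at the slope `A₃ := (3·(e·K₀(64,8)·9·64))⁻¹ = A∕3` (gen-12's lemmas BY NAME; the equality and the budget new) -/

/-- **THE FACTOR-3 CLAUSE HOLDS WITH EQUALITY AT `A₃`** — the sharp room is EXHAUSTED: `3·A₃·(e^{5·0+1}·K₀(64,8)·9·64) = 1`. [folklore] -/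
theorem h3_W_eq : 3 * (3 * (Real.exp 1 * K₀ 64 8 * 9 * 64))⁻¹ * (Real.exp (5 * 0 + 1) * K₀ 64 8 * 9 * 64) = 1 := by
  rw [mul_zero, zero_add, show 3 * (3 * (Real.exp 1 * K₀ 64 8 * 9 * 64))⁻¹ * (Real.exp 1 * K₀ 64 8 * 9 * 64) =
      (3 * (Real.exp 1 * K₀ 64 8 * 9 * 64))⁻¹ * (3 * (Real.exp 1 * K₀ 64 8 * 9 * 64)) by ring, inv_mul_cancel₀ prefactor3_pos.ne']

/-- **THE PENCIL BUDGET AT `ϱ⋆ = 2` IS PART 2's BUDGET**: `A₃ + 2·A₃ = 3·A₃ = A = 0 + 2·(A∕2)` (W33's `Acst = (e·K₀(64,8)·9·64)⁻¹`). [folklore] -/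
theorem budget_A3 : (3 * (Real.exp 1 * K₀ 64 8 * 9 * 64))⁻¹ + 2 * (3 * (Real.exp 1 * K₀ 64 8 * 9 * 64))⁻¹ = 0 + 2 * (Acst / 2) := by
  unfold Acst
  have h := prefactor_pos.ne'
  field_simp
  ring

section Torus
variable (N : ℕ) [NeZero N]

/-- **(B3) AT THE SHARP PENCIL RADIUS IS PART 2's `hM3_W`**: after `pencilRadius_three` (`max 2 (A₃∕A₃) = 2`) and `budget_A3` the ϱ-free END's
letter budget is LITERALLY PART 2 §5's. [folklore] -/
theorem hM3_sharp_W (k : ℕ) : ∀ Z : (tsys 4 N).Dom, Z.1 ⊆ (X₀ N).1 →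
    ∑ p ∈ (termsW D) N Z, (coreOf (PW D) ℂ (𝒵W D) (domW D) (JcW D) (VW D) (ℓW D) p.1 p.2).lam.real univ *
        ((coreOf (PW D) ℂ (𝒵W D) (domW D) (JcW D) (VW D) (ℓW D) p.1 p.2).wB *
            (gaussC ((mIW D) p.1 p.2) * Real.sqrt (max 1 ((Fintype.card ((mIW D) p.1 p.2)).factorial *
              (fun (_ : D.carriers.Dom) (_ : Unit) => (2 : ℝ)) p.1 p.2 ^ Fintype.card ((mIW D) p.1 p.2) +
              (fun (_ : D.carriers.Dom) (_ : Unit) => (2 : ℝ)) p.1 p.2))) * Real.exp 0) *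
        (Real.pi / (((fun (_ : D.carriers.Dom) (_ : Unit) => (2 : ℝ)) p.1 p.2 -
          Fintype.card ((mIW D) p.1 p.2) * (fun (_ : D.carriers.Dom) (_ : Unit) => ϑW) p.1 p.2 * (fun _ : ℕ => (1 : ℝ)) k) / 2 / 2)) ^
          (Module.finrank ℝ ((VW D) p.1 p.2) / 2 : ℝ) *
        Real.exp ((coreOf (PW D) ℂ (𝒵W D) (domW D) (JcW D) (VW D) (ℓW D) p.1 p.2).N₁ *
          (‖(0 : B13HistM (PW D))‖ + max 2 ((3 * (Real.exp 1 * K₀ 64 8 * 9 * 64))⁻¹ / (3 * (Real.exp 1 * K₀ 64 8 * 9 * 64))⁻¹) * ‖(wW D)‖)) ≤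
      ((3 * (Real.exp 1 * K₀ 64 8 * 9 * 64))⁻¹ +
          max 2 ((3 * (Real.exp 1 * K₀ 64 8 * 9 * 64))⁻¹ / (3 * (Real.exp 1 * K₀ 64 8 * 9 * 64))⁻¹) * (3 * (Real.exp 1 * K₀ 64 8 * 9 * 64))⁻¹) *
        Real.exp (-((2 * (64 * Real.log 162) + 2) * torusTreeLen Z.1)) := by
  rw [pencilRadius_three, budget_A3]
  exact (hM3_W D) N k

/-- The same for ROW NE5's `factorMass` currency at the floor `m⋆ = 1∕2` (PART 3's `hF3_W`). [folklore] -/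
theorem hF3_sharp_W : ∀ Z : (tsys 4 N).Dom, Z.1 ⊆ (X₀ N).1 →
    ∑ p ∈ (termsW D) N Z, factorMass (fun Z j => coreOf (PW D) ℂ (𝒵W D) (domW D) (JcW D) (VW D) (ℓW D) Z j)
        (fun Z j => gaussC ((mIW D) Z j) * Real.sqrt (max 1 ((Fintype.card ((mIW D) Z j)).factorial *
          (fun (_ : D.carriers.Dom) (_ : Unit) => (2 : ℝ)) Z j ^ Fintype.card ((mIW D) Z j) + (fun (_ : D.carriers.Dom) (_ : Unit) => (2 : ℝ)) Z j)))
        (fun _ _ => 0) (1 / 2)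
        (‖(0 : B13HistM (PW D))‖ + max 2 ((3 * (Real.exp 1 * K₀ 64 8 * 9 * 64))⁻¹ / (3 * (Real.exp 1 * K₀ 64 8 * 9 * 64))⁻¹) * ‖(wW D)‖) p.1 p.2 ≤
      ((3 * (Real.exp 1 * K₀ 64 8 * 9 * 64))⁻¹ +
          max 2 ((3 * (Real.exp 1 * K₀ 64 8 * 9 * 64))⁻¹ / (3 * (Real.exp 1 * K₀ 64 8 * 9 * 64))⁻¹) * (3 * (Real.exp 1 * K₀ 64 8 * 9 * 64))⁻¹) *
        Real.exp (-((2 * (64 * Real.log 162) + 2) * torusTreeLen Z.1)) := by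
  rw [pencilRadius_three, budget_A3]
  exact (hF3_W D) N

/-- … and with the Hermitian reading's N₀ letter (PART 3's `hF3_herm_W`). [folklore] -/
theorem hF3_herm_sharp_W : ∀ Z : (tsys 4 N).Dom, Z.1 ⊆ (X₀ N).1 →
    ∑ p ∈ (termsW D) N Z, factorMass (fun Z j => coreOf (PW D) ℂ (𝒵W D) (domW D) (JcW D) (VW D) (ℓW D) Z j)
        (fun Z j => gaussC ((mIW D) Z j) * Real.sqrt (max 1 ((Fintype.card ((mIW D) Z j)).factorial *
          (fun (_ : D.carriers.Dom) (_ : Unit) => (2 : ℝ)) Z j ^ Fintype.card ((mIW D) Z j) +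
          (fun (_ : D.carriers.Dom) (_ : Unit) => (2 : ℝ)) Z j ^ Fintype.card ((mIW D) Z j))))
        (fun _ _ => 0) (1 / 2)
        (‖(0 : B13HistM (PW D))‖ + max 2 ((3 * (Real.exp 1 * K₀ 64 8 * 9 * 64))⁻¹ / (3 * (Real.exp 1 * K₀ 64 8 * 9 * 64))⁻¹) * ‖(wW D)‖) p.1 p.2 ≤
      ((3 * (Real.exp 1 * K₀ 64 8 * 9 * 64))⁻¹ +
          max 2 ((3 * (Real.exp 1 * K₀ 64 8 * 9 * 64))⁻¹ / (3 * (Real.exp 1 * K₀ 64 8 * 9 * 64))⁻¹) * (3 * (Real.exp 1 * K₀ 64 8 * 9 * 64))⁻¹) *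
        Real.exp (-((2 * (64 * Real.log 162) + 2) * torusTreeLen Z.1)) := by
  rw [pencilRadius_three, budget_A3]
  exact (hF3_herm_W D) N

/-- The history condition at the sharp pencil radius: `‖0 − 0‖ + max 2 (A₃∕A₃)·‖wW‖ ≤ 2` (`= 2·‖wW‖ ≤ 2·sW ≤ 1∕32`). [folklore] -/
theorem hH_sharp_W :
    ‖(0 : B13HistM (PW D)) - 0‖ + max 2 ((3 * (Real.exp 1 * K₀ 64 8 * 9 * 64))⁻¹ / (3 * (Real.exp 1 * K₀ 64 8 * 9 * 64))⁻¹) * ‖(wW D)‖ ≤ 2 := by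
  rw [pencilRadius_three, sub_zero, norm_zero, zero_add]; linarith [(norm_wW_le D), sW_le]

/-! ## §17 THE THREE ϱ-FREE SHARP ENDs FIRE — S31 §1 ∕ S36 §2 ∕ S38 §2's printClause-three faces APPLIED ONCE BY NAME each -/

open Classical in
/-- **S31 §1's ϱ-FREE SHARP-ROOM-3 END FIRES ON THE TORUS, FOR EVERY DRIVEN TWO-RUN OBJECT `D` AND EVERY RUN-B BACKGROUND `U`** [decided toy]:
`attachedPart_locE_le_of_coreLettersOf_printClause_three_torus D (PW D) ℂ (𝒵W D) (domW D) (JcW D) (VW D) (mIW D) (AW D)` APPLIED ONCE BY NAME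
with PART 1's conditions `hbase_W`∕`hrdm_W`∕`hrd_W`∕`hctr_W`∕`hbud_W`∕`hmq_W`, `W := univ`, `(ROp, RHist, R′) := (1∕2, 2, 1)`, `(β₀, ϑ, d₀, γ) :=
(2, ϑW, 2, 2)`, `g := 0`, `o := 0`, `h₀ := 0`, `w := wW D`, live slope `A₀ = A₁ := A₃` (`hle := le_rfl`), `hH := hH_sharp_W` (at the face's own
radius `max 2 (A₃∕A₃)`), `emb Z := D.mkDom k (singleDom 0)`, `terms := termsW D N`, `(R, r₁) := (2·(64·log 162) + 2, 0)`, `hrate_torus_num`,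
`h3 := h3_torus` (EQUALITY, `h3_W_eq`), `hM3 := hM3_sharp_W` — NO radius binder.  The LEFT side is LITERALLY PART 2 §5's bounded quantity. [folklore] -/
theorem slotLettersSharpEnd_fires_torus (U : D.carriers.BgB) (k : ℕ) :
    ‖locE (Dom := (tsys 4 N).Dom) (TTouch (d := 4) (N := N)) (fun Z : (tsys 4 N).Dom => Z.1) ((actSW D) N ((0 : B13HistM (PW D)) + (wW D)))
          (X₀ N).1 -
        locE (Dom := (tsys 4 N).Dom) (TTouch (d := 4) (N := N)) (fun Z : (tsys 4 N).Dom => Z.1) ((actSW D) N 0) (X₀ N).1‖ ≤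
      4 * (Real.exp 1 * 9 * 64 * K₀ 64 8 ^ 2) * (3 * (Real.exp 1 * K₀ 64 8 * 9 * 64))⁻¹ * Real.exp (-(0 * torusTreeLen (X₀ N).1)) :=
  attachedPart_locE_le_of_coreLettersOf_printClause_three_torus D (PW D) ℂ (𝒵W D) (domW D) (JcW D) (VW D) (mIW D) (AW D)
    (W := Set.univ) (ctr := (ctrW D)) (ROp := fun _ => 1 / 2) (RHist := fun _ => 2) (R' := fun _ => 1)
    (β₀ := fun _ _ => 2) (ϑ := fun _ _ => ϑW) (d₀ := fun _ _ => 2) (γ := fun _ _ => 2)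
    (fun _ => by norm_num) (fun _ => zero_le_one) (hbase_W D) (hrdm_W D) (fun _ _ => by norm_num) (fun _ _ => by norm_num) (hrd_W D)
    (hctr_W D) (hbud_W D) (hmq_W D)
    (k := k) (g := fun _ => 0) (Set.mem_univ _) (U := U) (o := 0) (h₀ := 0) (w := (wW D))
    (A₀ := (3 * (Real.exp 1 * K₀ 64 8 * 9 * 64))⁻¹) (A₁ := (3 * (Real.exp 1 * K₀ 64 8 * 9 * 64))⁻¹)
    (by show ‖(0 : ℂ) - 0‖ ≤ 1 / 2; simp) (hH_sharp_W D)
    (emb := fun _ => D.mkDom k (singleDom 0)) (fun _ => rfl) ((termsW D) N)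
    (R := 2 * (64 * Real.log 162) + 2) (r₁ := 0) (X₀ N)
    (inv_nonneg.2 prefactor3_pos.le) (inv_pos.2 prefactor3_pos) le_rfl le_rfl hrate_torus_num h3_torus ((hM3_sharp_W D) N k)

open Classical in
/-- … in CLOSED FORM: `≤ 4∕3·K₀(64,8)` (`4·e·9·64·K₀²·A₃ = 4∕3·K₀`; decay factor `1` on the one cube). [folklore] -/
theorem slotLettersSharpEnd_fires_torus_closed (U : D.carriers.BgB) (k : ℕ) :
    ‖locE (Dom := (tsys 4 N).Dom) (TTouch (d := 4) (N := N)) (fun Z : (tsys 4 N).Dom => Z.1) ((actSW D) N ((0 : B13HistM (PW D)) + (wW D)))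
          (X₀ N).1 -
        locE (Dom := (tsys 4 N).Dom) (TTouch (d := 4) (N := N)) (fun Z : (tsys 4 N).Dom => Z.1) ((actSW D) N 0) (X₀ N).1‖ ≤ 4 / 3 * K₀ 64 8 := by
  refine ((slotLettersSharpEnd_fires_torus D) N U k).trans (le_of_eq ?_)
  rw [zero_mul, neg_zero, Real.exp_zero, mul_one]
  have hK := (K₀_pos (64 : ℝ) 8).ne'
  have he := (Real.exp_pos 1).ne'
  field_simp

open Classical in
/-- **S36 §2's ϱ-FREE SHARP END FIRES ON THE SAME DATUM — (B3) IN ROW NE5's `factorMass` CURRENCY AT THE FLOOR `m⋆ := 1∕2`** [decided toy]: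
`attachedPart_locE_le_of_coreLettersOf_factorMass_printClause_three_torus … (AW D)` APPLIED ONCE BY NAME (`hfloor_W`, `hF3 := hF3_sharp_W`). [folklore] -/
theorem slotLettersMassSharpEnd_fires_torus (U : D.carriers.BgB) (k : ℕ) :
    ‖locE (Dom := (tsys 4 N).Dom) (TTouch (d := 4) (N := N)) (fun Z : (tsys 4 N).Dom => Z.1) ((actSW D) N ((0 : B13HistM (PW D)) + (wW D)))
          (X₀ N).1 -
        locE (Dom := (tsys 4 N).Dom) (TTouch (d := 4) (N := N)) (fun Z : (tsys 4 N).Dom => Z.1) ((actSW D) N 0) (X₀ N).1‖ ≤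
      4 * (Real.exp 1 * 9 * 64 * K₀ 64 8 ^ 2) * (3 * (Real.exp 1 * K₀ 64 8 * 9 * 64))⁻¹ * Real.exp (-(0 * torusTreeLen (X₀ N).1)) :=
  attachedPart_locE_le_of_coreLettersOf_factorMass_printClause_three_torus D (PW D) ℂ (𝒵W D) (domW D) (JcW D) (VW D) (mIW D) (AW D)
    (W := Set.univ) (ctr := (ctrW D)) (ROp := fun _ => 1 / 2) (RHist := fun _ => 2) (R' := fun _ => 1)
    (β₀ := fun _ _ => 2) (ϑ := fun _ _ => ϑW) (d₀ := fun _ _ => 2) (γ := fun _ _ => 2) (mstar := 1 / 2)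
    (fun _ => by norm_num) (fun _ => zero_le_one) (hbase_W D) (hrdm_W D) (fun _ _ => by norm_num) (fun _ _ => by norm_num) (hrd_W D)
    (hctr_W D) (hbud_W D) (by norm_num) (hfloor_W D)
    (k := k) (g := fun _ => 0) (Set.mem_univ _) (U := U) (o := 0) (h₀ := 0) (w := (wW D))
    (A₀ := (3 * (Real.exp 1 * K₀ 64 8 * 9 * 64))⁻¹) (A₁ := (3 * (Real.exp 1 * K₀ 64 8 * 9 * 64))⁻¹)
    (by show ‖(0 : ℂ) - 0‖ ≤ 1 / 2; simp) (hH_sharp_W D)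
    (emb := fun _ => D.mkDom k (singleDom 0)) (fun _ => rfl) ((termsW D) N)
    (R := 2 * (64 * Real.log 162) + 2) (r₁ := 0) (X₀ N)
    (inv_nonneg.2 prefactor3_pos.le) (inv_pos.2 prefactor3_pos) le_rfl le_rfl hrate_torus_num h3_torus ((hF3_sharp_W D) N)

open Classical in
/-- **S38 §2's ϱ-FREE SHARP END FIRES ON THE SAME DATUM — THE HERMITIAN CENTRE READING** [decided toy]:
`attachedPart_locE_le_of_coreLettersOf_herm_printClause_three_torus … (AW D)` APPLIED ONCE BY NAME (`hent_W`∕`hherm_W`∕`hco_W`∕`hbud_herm_W`,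
`hfloor_W`, `hF3 := hF3_herm_sharp_W`). [folklore] -/
theorem slotLettersHermSharpEnd_fires_torus (U : D.carriers.BgB) (k : ℕ) :
    ‖locE (Dom := (tsys 4 N).Dom) (TTouch (d := 4) (N := N)) (fun Z : (tsys 4 N).Dom => Z.1) ((actSW D) N ((0 : B13HistM (PW D)) + (wW D)))
          (X₀ N).1 -
        locE (Dom := (tsys 4 N).Dom) (TTouch (d := 4) (N := N)) (fun Z : (tsys 4 N).Dom => Z.1) ((actSW D) N 0) (X₀ N).1‖ ≤
      4 * (Real.exp 1 * 9 * 64 * K₀ 64 8 ^ 2) * (3 * (Real.exp 1 * K₀ 64 8 * 9 * 64))⁻¹ * Real.exp (-(0 * torusTreeLen (X₀ N).1)) :=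
  attachedPart_locE_le_of_coreLettersOf_herm_printClause_three_torus D (PW D) ℂ (𝒵W D) (domW D) (JcW D) (VW D) (mIW D) (AW D)
    (W := Set.univ) (ctr := (ctrW D)) (ROp := fun _ => 1 / 2) (RHist := fun _ => 2) (R' := fun _ => 1)
    (β₀ := fun _ _ => 2) (ϑ := fun _ _ => ϑW) (γ := fun _ _ => 2) (mstar := 1 / 2)
    (fun _ => by norm_num) (fun _ => zero_le_one) (hbase_W D) (hrdm_W D) (fun _ _ => by norm_num) (hrd_W D)
    (hent_W D) (hherm_W D) (hco_W D) (hbud_herm_W D) (by norm_num) (hfloor_W D)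
    (k := k) (g := fun _ => 0) (Set.mem_univ _) (U := U) (o := 0) (h₀ := 0) (w := (wW D))
    (A₀ := (3 * (Real.exp 1 * K₀ 64 8 * 9 * 64))⁻¹) (A₁ := (3 * (Real.exp 1 * K₀ 64 8 * 9 * 64))⁻¹)
    (by show ‖(0 : ℂ) - 0‖ ≤ 1 / 2; simp) (hH_sharp_W D)
    (emb := fun _ => D.mkDom k (singleDom 0)) (fun _ => rfl) ((termsW D) N)
    (R := 2 * (64 * Real.log 162) + 2) (r₁ := 0) (X₀ N)
    (inv_nonneg.2 prefactor3_pos.le) (inv_pos.2 prefactor3_pos) le_rfl le_rfl hrate_torus_num h3_torus ((hF3_herm_sharp_W D) N)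

/-! ## §18 GENUINE: on the SAME bounded quantity the ϱ-free sharp constant is two thirds of the radius route's; the quantity is live
(the factor-4 clause's failure at this slope is gen-12's `DressedSmallFieldTorusWitnessSharp.not_h4_at_A3`, BY NAME) -/

/-- **OUR CONSTANTS COMPARED ON ONE QUANTITY**: the ϱ-free sharp END's closed constant `4∕3·K₀(64,8)` is STRICTLY below PART 2 §5's
radius-route closed constant `2·K₀(64,8)` (`slotLettersEnd_fires_torus_closed`) — both bound the same `locE` difference. [folklore] -/
theorem sharp_lt_radiusRoute : 4 / 3 * K₀ (64 : ℝ) 8 < 2 * K₀ 64 8 := by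
  have hK := K₀_pos (64 : ℝ) 8
  nlinarith

open Classical in
/-- **THE SHARP END's BOUNDED QUANTITY IS LIVE AND BOUNDED BY BOTH ROUTES**: `≠ 0` (PART 2 §6 `slotLettersEnd_live` BY NAME), `≤ 4∕3·K₀(64,8)`
(sharp, ϱ-free) and `≤ 2·K₀(64,8)` (PART 2 §5, radius `ϱ = 2`). [folklore] -/
theorem slotLettersSharpEnd_live (U : D.carriers.BgB) (k : ℕ) :
    locE (Dom := (tsys 4 N).Dom) (TTouch (d := 4) (N := N)) (fun Z : (tsys 4 N).Dom => Z.1) ((actSW D) N ((0 : B13HistM (PW D)) + (wW D)))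
          (X₀ N).1 -
        locE (Dom := (tsys 4 N).Dom) (TTouch (d := 4) (N := N)) (fun Z : (tsys 4 N).Dom => Z.1) ((actSW D) N 0) (X₀ N).1 ≠ 0 ∧
      ‖locE (Dom := (tsys 4 N).Dom) (TTouch (d := 4) (N := N)) (fun Z : (tsys 4 N).Dom => Z.1) ((actSW D) N ((0 : B13HistM (PW D)) + (wW D)))
            (X₀ N).1 -
          locE (Dom := (tsys 4 N).Dom) (TTouch (d := 4) (N := N)) (fun Z : (tsys 4 N).Dom => Z.1) ((actSW D) N 0) (X₀ N).1‖ ≤ 4 / 3 * K₀ 64 8 ∧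
      ‖locE (Dom := (tsys 4 N).Dom) (TTouch (d := 4) (N := N)) (fun Z : (tsys 4 N).Dom => Z.1) ((actSW D) N ((0 : B13HistM (PW D)) + (wW D)))
            (X₀ N).1 -
          locE (Dom := (tsys 4 N).Dom) (TTouch (d := 4) (N := N)) (fun Z : (tsys 4 N).Dom => Z.1) ((actSW D) N 0) (X₀ N).1‖ ≤ 2 * K₀ 64 8 :=
  ⟨sub_ne_zero.2 ((slotLettersEnd_live D) N), (slotLettersSharpEnd_fires_torus_closed D) N U k, (slotLettersEnd_fires_torus_closed D) N U k⟩

end Torus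

/-! ## §19 … OVER THE DRIVEN RUNS OF RECORD AT `SU(2)` (PART 2 §7's hypothesis-free `DW`, `UW`) -/

open Classical in
/-- **THE ϱ-FREE SHARP END FIRES ON THE TORUS OVER THE DRIVEN RUNS OF RECORD AT `SU(2)`** (§17 closed form at `D := DW`, `U := UW`). [folklore] -/
theorem slotLettersSharpEnd_fires_torus_SU2 (N : ℕ) [NeZero N] (k : ℕ) :
    ‖locE (Dom := (tsys 4 N).Dom) (TTouch (d := 4) (N := N)) (fun Z : (tsys 4 N).Dom => Z.1) (actSW DW N ((0 : B13HistM (PW DW)) + wW DW))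
          (X₀ N).1 -
        locE (Dom := (tsys 4 N).Dom) (TTouch (d := 4) (N := N)) (fun Z : (tsys 4 N).Dom => Z.1) (actSW DW N 0) (X₀ N).1‖ ≤ 4 / 3 * K₀ 64 8 :=
  slotLettersSharpEnd_fires_torus_closed DW N UW k

end Summit.QuantumFields.BalabanUV.T4Continuum.NE1p.DressedSmallFieldSlotLettersWitnessSharp
end
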